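import Summits.QuantumFields.YangMills.Theorems.BalabanUVNodesK2NamedJetsLimit
import Summits.QuantumFields.BalabanUV.Gaps.D1PinnedColourPolynomial

/-!
# Crux K2⁷ `EndpointGivenBR13SepCoPH` (stmt-QuantumFields-20543), (D1) side — «ONE COEFFICIENT, TWO VERDICTS»: the two SECOND-ORDER letters of the named one-loop limit
# `CauchyRate.lim (beta0OfJs F κ)` — the border slope `σ_F` and the position-table response `ρ_F` — read for DEF-1's colour data `StepColourData`; if EITHER is non-zero at a family
# `F`, every real number is a limit there, so the DRIFT VARIETY of `F` is NON-EMPTY AND PROPER: the dealt road «(D1) at every κ» is DEAD (seat d1-w1's kill-target fires) and, at the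
# same stroke, plan g83's θ-FREE (D1) text 1ᴰ `∃ κ⋆, ∀ F, ∃ A, OneLoopDrift (stepBal 2 F.L) A (beta0OfJs F (κ⋆ F.L))` HOLDS — without anybody naming print's colour weights

Cell `ym-nodeO-ideate`, seat `ym-nodeO-d1-w1` (gen 2; director-ym R399 (3a) ∕ №207: «land `stub_d1AnchoredJets13 : D1AtAnchoredJets` via `d1AtAnchoredJets_of_d1Drift_all`»; gen 0's
verdict «1ᴬ stub-misstated AS DEALT» = the reading of record, plan g83 WORDS-3; the plan's interim ask to the (D1) side: «θ-free member identities … ANY certified member off the variety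
KILLS the dealt road»).  `--kind proof --supports stmt-QuantumFields-20543 --as helper`; count-neutral.  0 `def`: the two letters are written INLINE as differences of limits at NAMED
members (`⟨0,0,0,1,0⟩`, `⟨0,0,0,0,E⟩`, `⟨0,0,0,0,0⟩ : StepColourData`); every other text BY NAME — gen 0's `…K2NamedJetsLimit` (`drift_iff_lim_eq`, `not_d1DriftAll_of_lim_ne`,
`EndpointGivenBR13SepCoPH_of_runRemAtOnVariety`), g1-p1's universal normal form `Gaps.D1PinnedColourPolynomial.lim_normalForm_universal` (`γ + Φ(c⃗) + cB·σ + Λ(Tc)`, read for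
`beta0OfJs` in a PRIVATE lemma whose public twin is seat d1-w2's `…K2D1DriftAllPrice.lim_beta0OfJs_normalForm`, p608845 — not imported only because its farm olean was not yet
built at filing time), DEF-1's `K2V6Defs` (`Window13`, `EndpointGivenBR13SepCoPH_of_pin`).

THE POINT.  Write `lim_F κ := CauchyRate.lim (beta0OfJs F κ)` (hypothesis-free limit, gen 0 `tendsto_beta0OfJs`).  By d1-w2's normal form `lim_F ⟨cE,cVH,cΛ,cB,Tc⟩ = γ_F + Φ_F(cE,cVH,cΛ)
+ cB·σ_F + Λ_F(Tc)` (`Φ_F(0⃗) = 0`, `Λ_F` linear), so the two second-order letters are INTRINSIC member differences (§1): `σ_F = lim_F ⟨0,0,0,1,0⟩ − lim_F ⟨0,0,0,0,0⟩` (`lim_border_translate`),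
`ρ_F(E) = lim_F ⟨0,0,0,0,E⟩ − lim_F ⟨0,0,0,0,0⟩` (`lim_table_translate`; additive, homogeneous), and `lim_F κ = lim_F ⟨κ.cE,κ.cVH,κ.cΛ,0,0⟩ + κ.cB·σ_F + ρ_F(κ.Tc)` (`lim_secondOrder_split`).  THEN:
* §2 `σ_F ≠ 0` (resp. `ρ_F(E) ≠ 0` for ONE table `E`) ⟹ EVERY real `t` is some `lim_F κ` ⟹ (i) some κ is ON the drift variety `lim_F κ = stepBal 2 F.L` (⟺ `∃ A, OneLoopDrift (stepBal 2 F.L) A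
  (beta0OfJs F κ)`, gen 0 `drift_iff_lim_eq`), (ii) some κ is OFF it, (iii) the dealt road's hypothesis «(D1) at every κ of every family» is FALSE (gen 0's `not_d1DriftAll_of_lim_ne`) —
  ★ `twoVerdicts_of_borderSlope_ne` ∕ `twoVerdicts_of_tableResponse_ne`; and under `σ_F ≠ 0` the variety is the GRAPH `cB = (stepBal 2 F.L − lim_F ⟨cE,cVH,cΛ,0,Tc⟩) ∕ σ_F` over the other
  259 coordinates (`onVariety_iff_borderWeight_eq_of_borderSlope_ne`, `existsUnique_borderWeight_onVariety_…`): it projects ONTO every first-order colour triple — so a run text quantified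
  over the WHOLE variety (plan g83 (β2)'s 2ᴼ) asks the run letter at ARBITRARY first-order weights; a NAMED SUB-CLASS is the honest quantifier.
* §3 PRICES per family, intrinsic: an EMPTY variety at `F` forces `σ_F = 0 ∧ ρ_F ≡ 0` exactly as the FULL one does (d1-w2's `normalForm_trivial_of_d1DriftAll`, here per family); in that
  second-order-BLIND case the variety question at `F` is the colour quartic ALONE (`drift_iff_colourTriple_of_secondOrderBlind`).
* §4 `beta0OfJs_eq_of_L_eq` (a family enters only through `F.L`) ⟹ ★ `exists_pin_drift_of_secondOrder_nonblind`: «σ_F ≠ 0 or some ρ_F(E) ≠ 0 at every family» ⟹ plan g83 (β2)'s θ-free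
  text 1ᴰ = the `hD1` hypothesis of DEF-1's `K2V6Defs.EndpointGivenBR13SepCoPH_of_pin` for SOME pin `κ⋆ : ℕ → StepColourData` (chosen per block; NOT print's (P6) datum).
* §5 ★★ `EndpointGivenBR13SepCoPH_of_secondOrder_nonblind_runOnVariety` ∕ `…_runAtPins`: non-blindness at every family + the run letter `RunRemAt F κ θ hP θ.cβ` at the colour data ON the
  variety (resp. at drifting pins), under v6's prefix ⟹ THE CRUX DECL BY NAME (gen 0's LINE 1″ concluder ∕ DEF-1's `_of_pin`).
READING (zero weight): the kill-list of the dealt road and the life-list of the re-dealt θ-free stub are ONE list — `σ_L`, `Λ_L(E)` (odd `L ≥ 13`, `T4Family.hL11`).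

HONEST FRAMING.  [folklore] elementary real algebra + bookkeeping BY NAME over tree theorems; NOTHING of Bałaban's analysis is asserted; NO coefficient (`σ_F`, `ρ_F(E)`, `γ_F`, `Φ_F`, any
limit) is computed or signed — every ★ has a non-blindness HYPOTHESIS on the left (instance 0∕1); (D1) is NOT discharged at any colour datum; `stub_d1AnchoredJets13` (1ᴬ) is NOT proved
and is not fileable as dealt (gen 0's verdict stands); `stub_runRemNamedJets13`, 1ᴰ, 2ᴼ and K2⁷ are NOT proved; (P6) NOT decided; skeleton v6 `5a75a2378c79b303` untouched; counts UNMOVED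
(typed 28∕28 · discharged 5∕27 (A 5∕28)); [Balaban1987RG1] Thm 2 + (0.31) p. 259 (NODE O) is UNPROVED IN PRINT.  Route R4 closes the CONDITIONAL finite-𝕋⁴ rung `BalabanLadder.UV`
only — NOT continuum, NOT ℝ⁴, NOT OS, NOT a mass gap; the Clay YM mass gap is NOT proved by any of this; no summit statement is proved by this seat.  No `def`, no `instance`, no
`notation`, no `axiom`, 0 `sorry`.  Sources (context only; nothing printed is used as a hypothesis): [I] = [Balaban1987RG1] CMP **109** (1987): Thm 2 p. 259, (1.3) p. 260, (1.22)
p. 264, (2.12)–(2.14) p. 268, (5.10) p. 293.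
-/

noncomputable section

namespace Summit.QuantumFields.YangMills.Theorems.BalabanUVNodesK2D1VarietySecondOrder

open Filter Topology
open Literature.MathematicalPhysics.QuantumFieldTheory.Balaban1983to89
open Literature.MathematicalPhysics.QuantumFieldTheory.Balaban1983to89.T4Continuum (T4Family)
open Literature.MathematicalPhysics.QuantumFieldTheory.Balaban1983to89.Beta.Drift (OneLoopDrift)
open Literature.MathematicalPhysics.QuantumFieldTheory.Balaban1983to89.Beta.RateCertificate (CauchyRate)
open Summit.QuantumFields.YangMills.Theorems.BalabanUVNodesK2JsOfRecord (StepColourData beta0OfJs)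
open Summit.QuantumFields.YangMills.Theorems.BalabanUVNodesK2NamedJetsRunRemAt (RunRemAt)
open Summit.QuantumFields.YangMills.Theorems.BalabanUVNodesK2V6Defs (Window13 EndpointGivenBR13SepCoPH_of_pin)
open Summit.QuantumFields.YangMills.Theorems.BalabanUVNodesK2NamedJetsLimit (drift_iff_lim_eq not_d1DriftAll_of_lim_ne
  EndpointGivenBR13SepCoPH_of_runRemAtOnVariety)
open Literature.MathematicalPhysics.QuantumFieldTheory.Balaban1983to89.Beta.AveragingContoursRooted (ctrOff ctrOff_mem_box)
open Summit.QuantumFields.BalabanUV.Gaps.D1PinnedColourPolynomial (lim_normalForm_universal)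

/-- PRIVATE twin of seat d1-w2's public `BalabanUVNodesK2D1DriftAllPrice.lim_beta0OfJs_normalForm` (p608845; same statement, same 4-line proof over g1-p1's
`lim_normalForm_universal` at the centred root — kept private here only because that module's farm olean was unavailable at filing time; cite the public one):
`CauchyRate.lim (beta0OfJs F κ) = γ + Φ(cE,cVH,cΛ) + cB·σ + Λ(Tc)` with `Φ` of total degree ≤ 4, no linear part, no constant, `Λ` linear. [folklore] -/
private theorem lim_beta0OfJs_normalForm (F : T4Family) :
    ∃ (Φ : MvPolynomial (Fin 3) ℝ) (Λ : (Fin 4 → Fin 4 → Fin 4 → Fin 4 → ℝ) →ₗ[ℝ] ℝ) (γ σ : ℝ),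
      Φ.totalDegree ≤ 4 ∧ Φ.homogeneousComponent 1 = 0 ∧ Φ.coeff 0 = 0 ∧
      ∀ κ : StepColourData, CauchyRate.lim (beta0OfJs F κ) = γ + MvPolynomial.eval ![κ.cE, κ.cVH, κ.cΛ] Φ + κ.cB * σ + Λ κ.Tc := by
  haveI : NeZero F.L := ⟨by have := F.hL.2; omega⟩
  obtain ⟨Φ, Λ, h4, h1, h0, h⟩ := lim_normalForm_universal (Lc := F.L) F.hL.2 (ctrOff_mem_box (d := 3 + 1) F.hL.2.le) 0 1
  obtain ⟨γ, σ, hγ⟩ := h (ctrOff (3 + 1) F.L) (ctrOff_mem_box F.hL.2.le)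
  exact ⟨Φ, Λ, γ, σ, h4, h1, h0, fun κ => hγ κ.cE κ.cVH κ.cΛ κ.cB κ.Tc⟩

/-! ## §1 The two second-order letters as INTRINSIC member differences; the split of the limit -/

section Letters

variable (F : T4Family)

/-- the colour triple of the zero datum is the zero point of `ℝ³`. [folklore] -/
private theorem vec3_zero : (![(0 : ℝ), 0, 0] : Fin 3 → ℝ) = 0 := by
  funext i; fin_cases i <;> rfl

/-- a polynomial without constant term vanishes at the zero colour triple. [folklore] -/
private theorem eval_zero_of_coeff_zero {Φ : MvPolynomial (Fin 3) ℝ} (h0 : Φ.coeff 0 = 0) :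
    MvPolynomial.eval ![(0 : ℝ), 0, 0] Φ = 0 := by
  rw [vec3_zero, MvPolynomial.eval_zero]; exact h0

/-- **THE BORDER LETTER IS INTRINSIC — `lim_F` IS A TRANSLATE IN `cB`**: for every colour datum,
`lim_F ⟨cE,cVH,cΛ,cB,Tc⟩ = lim_F ⟨cE,cVH,cΛ,0,Tc⟩ + cB · (lim_F ⟨0,0,0,1,0⟩ − lim_F ⟨0,0,0,0,0⟩)` — the bracket is the border slope `σ_F` of the normal form, read at two NAMED members
(d1-w2's `lim_beta0OfJs_normalForm`; g1-p1's `Gaps.D1PinnedResponseTowers.lim_border_affine` ∕ `…SecondOrderUniversal` underneath).  Hypothesis-free. [folklore] -/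
theorem lim_border_translate (cE cVH cΛ cB : ℝ) (Tc : Fin 4 → Fin 4 → Fin 4 → Fin 4 → ℝ) :
    CauchyRate.lim (beta0OfJs F ⟨cE, cVH, cΛ, cB, Tc⟩) =
      CauchyRate.lim (beta0OfJs F ⟨cE, cVH, cΛ, 0, Tc⟩) +
        cB * (CauchyRate.lim (beta0OfJs F ⟨0, 0, 0, 1, 0⟩) - CauchyRate.lim (beta0OfJs F ⟨0, 0, 0, 0, 0⟩)) := by
  obtain ⟨Φ, Λ, γ, σ, -, -, h0, h⟩ := lim_beta0OfJs_normalForm F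
  rw [h ⟨cE, cVH, cΛ, cB, Tc⟩, h ⟨cE, cVH, cΛ, 0, Tc⟩, h ⟨0, 0, 0, 1, 0⟩, h ⟨0, 0, 0, 0, 0⟩]
  simp only [eval_zero_of_coeff_zero h0, map_zero]
  ring

/-- **THE TABLE LETTER IS INTRINSIC — `lim_F` IS A TRANSLATE IN `Tc`**: `lim_F ⟨cE,cVH,cΛ,cB,Tc⟩ = lim_F ⟨cE,cVH,cΛ,cB,0⟩ + (lim_F ⟨0,0,0,0,Tc⟩ − lim_F ⟨0,0,0,0,0⟩)` — the bracket is the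
table response `ρ_F(Tc) = Λ_F(Tc)` of the normal form (g1-p1's `Gaps.D1PinnedPositionTableAffine` ∕ `…TableResponseUniversal` underneath).  Hypothesis-free. [folklore] -/
theorem lim_table_translate (cE cVH cΛ cB : ℝ) (Tc : Fin 4 → Fin 4 → Fin 4 → Fin 4 → ℝ) :
    CauchyRate.lim (beta0OfJs F ⟨cE, cVH, cΛ, cB, Tc⟩) =
      CauchyRate.lim (beta0OfJs F ⟨cE, cVH, cΛ, cB, 0⟩) +
        (CauchyRate.lim (beta0OfJs F ⟨0, 0, 0, 0, Tc⟩) - CauchyRate.lim (beta0OfJs F ⟨0, 0, 0, 0, 0⟩)) := by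
  obtain ⟨Φ, Λ, γ, σ, -, -, h0, h⟩ := lim_beta0OfJs_normalForm F
  rw [h ⟨cE, cVH, cΛ, cB, Tc⟩, h ⟨cE, cVH, cΛ, cB, 0⟩, h ⟨0, 0, 0, 0, Tc⟩, h ⟨0, 0, 0, 0, 0⟩]
  simp only [eval_zero_of_coeff_zero h0, map_zero]
  ring

/-- the table response is ADDITIVE … [folklore] -/
theorem tableResponse_add (E E' : Fin 4 → Fin 4 → Fin 4 → Fin 4 → ℝ) :
    CauchyRate.lim (beta0OfJs F ⟨0, 0, 0, 0, E + E'⟩) - CauchyRate.lim (beta0OfJs F ⟨0, 0, 0, 0, 0⟩) =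
      (CauchyRate.lim (beta0OfJs F ⟨0, 0, 0, 0, E⟩) - CauchyRate.lim (beta0OfJs F ⟨0, 0, 0, 0, 0⟩)) +
        (CauchyRate.lim (beta0OfJs F ⟨0, 0, 0, 0, E'⟩) - CauchyRate.lim (beta0OfJs F ⟨0, 0, 0, 0, 0⟩)) := by
  obtain ⟨Φ, Λ, γ, σ, -, -, -, h⟩ := lim_beta0OfJs_normalForm F
  rw [h ⟨0, 0, 0, 0, E + E'⟩, h ⟨0, 0, 0, 0, E⟩, h ⟨0, 0, 0, 0, E'⟩, h ⟨0, 0, 0, 0, 0⟩]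
  simp only [map_add, map_zero]
  ring

/-- … and HOMOGENEOUS: `ρ_F(s • E) = s · ρ_F(E)`. [folklore] -/
theorem tableResponse_smul (s : ℝ) (E : Fin 4 → Fin 4 → Fin 4 → Fin 4 → ℝ) :
    CauchyRate.lim (beta0OfJs F ⟨0, 0, 0, 0, s • E⟩) - CauchyRate.lim (beta0OfJs F ⟨0, 0, 0, 0, 0⟩) =
      s * (CauchyRate.lim (beta0OfJs F ⟨0, 0, 0, 0, E⟩) - CauchyRate.lim (beta0OfJs F ⟨0, 0, 0, 0, 0⟩)) := by
  obtain ⟨Φ, Λ, γ, σ, -, -, -, h⟩ := lim_beta0OfJs_normalForm F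
  rw [h ⟨0, 0, 0, 0, s • E⟩, h ⟨0, 0, 0, 0, E⟩, h ⟨0, 0, 0, 0, 0⟩]
  simp only [map_smul, map_zero, smul_eq_mul]
  ring

/-- **THE SECOND-ORDER SPLIT OF THE LIMIT** (d1-w2's normal form with the two second-order letters made intrinsic): for every colour datum
`lim_F κ = lim_F ⟨κ.cE, κ.cVH, κ.cΛ, 0, 0⟩ + κ.cB · σ_F + ρ_F(κ.Tc)`. [folklore] -/
theorem lim_secondOrder_split (κ : StepColourData) :
    CauchyRate.lim (beta0OfJs F κ) =
      CauchyRate.lim (beta0OfJs F ⟨κ.cE, κ.cVH, κ.cΛ, 0, 0⟩) +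
        κ.cB * (CauchyRate.lim (beta0OfJs F ⟨0, 0, 0, 1, 0⟩) - CauchyRate.lim (beta0OfJs F ⟨0, 0, 0, 0, 0⟩)) +
        (CauchyRate.lim (beta0OfJs F ⟨0, 0, 0, 0, κ.Tc⟩) - CauchyRate.lim (beta0OfJs F ⟨0, 0, 0, 0, 0⟩)) := by
  obtain ⟨cE, cVH, cΛ, cB, Tc⟩ := κ
  dsimp only
  linear_combination lim_table_translate F cE cVH cΛ cB Tc + lim_border_translate F cE cVH cΛ cB 0

end Letters

/-! ## §2 ONE non-zero second-order coefficient ⟹ every real value is a limit ⟹ the variety is NON-EMPTY AND PROPER ⟹ the dealt road is dead -/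

section TwoVerdicts

variable (F : T4Family)

/-- **`σ_F ≠ 0` ⟹ EVERY REAL NUMBER IS A LIMIT AT `F`** (move the border weight: κ := `⟨0,0,0,(t − lim_F 0)/σ_F, 0⟩`; g1-p1's `exists_borderWeight_lim_eq` read for `beta0OfJs`). [folklore] -/
theorem exists_lim_eq_of_borderSlope_ne
    (hσ : CauchyRate.lim (beta0OfJs F ⟨0, 0, 0, 1, 0⟩) - CauchyRate.lim (beta0OfJs F ⟨0, 0, 0, 0, 0⟩) ≠ 0) (t : ℝ) :
    ∃ κ : StepColourData, CauchyRate.lim (beta0OfJs F κ) = t := by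
  refine ⟨⟨0, 0, 0, (t - CauchyRate.lim (beta0OfJs F ⟨0, 0, 0, 0, 0⟩)) /
    (CauchyRate.lim (beta0OfJs F ⟨0, 0, 0, 1, 0⟩) - CauchyRate.lim (beta0OfJs F ⟨0, 0, 0, 0, 0⟩)), 0⟩, ?_⟩
  rw [lim_border_translate, div_mul_cancel₀ _ hσ]
  ring

/-- **`ρ_F(E) ≠ 0` for ONE table `E` ⟹ EVERY REAL NUMBER IS A LIMIT AT `F`** (slide along the table line `s • E`; g1-p1's `exists_tableLine_lim_eq` read for `beta0OfJs`). [folklore] -/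
theorem exists_lim_eq_of_tableResponse_ne {E : Fin 4 → Fin 4 → Fin 4 → Fin 4 → ℝ}
    (hρ : CauchyRate.lim (beta0OfJs F ⟨0, 0, 0, 0, E⟩) - CauchyRate.lim (beta0OfJs F ⟨0, 0, 0, 0, 0⟩) ≠ 0) (t : ℝ) :
    ∃ κ : StepColourData, CauchyRate.lim (beta0OfJs F κ) = t := by
  refine ⟨⟨0, 0, 0, 0, ((t - CauchyRate.lim (beta0OfJs F ⟨0, 0, 0, 0, 0⟩)) /
    (CauchyRate.lim (beta0OfJs F ⟨0, 0, 0, 0, E⟩) - CauchyRate.lim (beta0OfJs F ⟨0, 0, 0, 0, 0⟩))) • E⟩, ?_⟩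
  have h := tableResponse_smul F ((t - CauchyRate.lim (beta0OfJs F ⟨0, 0, 0, 0, 0⟩)) /
    (CauchyRate.lim (beta0OfJs F ⟨0, 0, 0, 0, E⟩) - CauchyRate.lim (beta0OfJs F ⟨0, 0, 0, 0, 0⟩))) E
  rw [div_mul_cancel₀ _ hρ] at h
  linarith

/-- every real value a limit ⟹ SOME colour datum is ON the drift variety of `F`: `∃ κ A, OneLoopDrift (stepBal 2 F.L) A (beta0OfJs F κ)` (gen 0's `drift_iff_lim_eq`). [folklore] -/
theorem exists_drift_of_forall_exists_lim (h : ∀ t : ℝ, ∃ κ : StepColourData, CauchyRate.lim (beta0OfJs F κ) = t) :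
    ∃ (κ : StepColourData) (A : ℝ), OneLoopDrift (B12Normalization.stepBal 2 F.L) A (beta0OfJs F κ) := by
  obtain ⟨κ, hκ⟩ := h (B12Normalization.stepBal 2 F.L)
  obtain ⟨A, hA⟩ := (drift_iff_lim_eq F κ 2).mpr hκ
  exact ⟨κ, A, hA⟩

/-- every real value a limit ⟹ SOME colour datum is OFF the drift variety of `F` (its limit is `stepBal 2 F.L + 1`). [folklore] -/
theorem exists_not_drift_of_forall_exists_lim (h : ∀ t : ℝ, ∃ κ : StepColourData, CauchyRate.lim (beta0OfJs F κ) = t) :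
    ∃ κ : StepColourData, CauchyRate.lim (beta0OfJs F κ) ≠ B12Normalization.stepBal 2 F.L ∧
      ¬ ∃ A : ℝ, OneLoopDrift (B12Normalization.stepBal 2 F.L) A (beta0OfJs F κ) := by
  obtain ⟨κ, hκ⟩ := h (B12Normalization.stepBal 2 F.L + 1)
  have hne : CauchyRate.lim (beta0OfJs F κ) ≠ B12Normalization.stepBal 2 F.L := by rw [hκ]; linarith
  exact ⟨κ, hne, fun hd => hne ((drift_iff_lim_eq F κ 2).mp hd)⟩

/-- every real value a limit at ONE family ⟹ the dealt road's hypothesis «(D1) at every colour datum of every family» is FALSE (gen 0's kill-target `not_d1DriftAll_of_lim_ne` FIRES). [folklore] -/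
theorem not_d1DriftAll_of_forall_exists_lim (h : ∀ t : ℝ, ∃ κ : StepColourData, CauchyRate.lim (beta0OfJs F κ) = t) :
    ¬ ∀ (F : T4Family) (κ : StepColourData), ∃ A : ℝ, OneLoopDrift (B12Normalization.stepBal 2 F.L) A (beta0OfJs F κ) := by
  obtain ⟨κ, hne, -⟩ := exists_not_drift_of_forall_exists_lim F h
  exact not_d1DriftAll_of_lim_ne hne

/-- **★ ONE COEFFICIENT, TWO VERDICTS (border edition)**: `σ_F ≠ 0` at ONE family ⟹ (i) some colour datum of `F` is ON the drift variety, (ii) some colour datum of `F` is OFF it, (iii) the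
dealt road `d1AtAnchoredJets_of_d1Drift_all`'s hypothesis is false.  The SAME certified number kills the road of R399 (3a) and inhabits the variety the re-dealt (D1) stub needs at `F`.
NO value of `σ_F` is computed here. [folklore] -/
theorem twoVerdicts_of_borderSlope_ne
    (hσ : CauchyRate.lim (beta0OfJs F ⟨0, 0, 0, 1, 0⟩) - CauchyRate.lim (beta0OfJs F ⟨0, 0, 0, 0, 0⟩) ≠ 0) :
    (∃ (κ : StepColourData) (A : ℝ), OneLoopDrift (B12Normalization.stepBal 2 F.L) A (beta0OfJs F κ)) ∧
    (∃ κ : StepColourData, ¬ ∃ A : ℝ, OneLoopDrift (B12Normalization.stepBal 2 F.L) A (beta0OfJs F κ)) ∧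
    ¬ ∀ (F : T4Family) (κ : StepColourData), ∃ A : ℝ, OneLoopDrift (B12Normalization.stepBal 2 F.L) A (beta0OfJs F κ) := by
  have h := exists_lim_eq_of_borderSlope_ne F hσ
  obtain ⟨κ, -, hκ⟩ := exists_not_drift_of_forall_exists_lim F h
  exact ⟨exists_drift_of_forall_exists_lim F h, ⟨κ, hκ⟩, not_d1DriftAll_of_forall_exists_lim F h⟩

/-- **★ ONE COEFFICIENT, TWO VERDICTS (table edition)**: `ρ_F(E) ≠ 0` for ONE position table `E` at ONE family ⟹ the same three conclusions. [folklore] -/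
theorem twoVerdicts_of_tableResponse_ne {E : Fin 4 → Fin 4 → Fin 4 → Fin 4 → ℝ}
    (hρ : CauchyRate.lim (beta0OfJs F ⟨0, 0, 0, 0, E⟩) - CauchyRate.lim (beta0OfJs F ⟨0, 0, 0, 0, 0⟩) ≠ 0) :
    (∃ (κ : StepColourData) (A : ℝ), OneLoopDrift (B12Normalization.stepBal 2 F.L) A (beta0OfJs F κ)) ∧
    (∃ κ : StepColourData, ¬ ∃ A : ℝ, OneLoopDrift (B12Normalization.stepBal 2 F.L) A (beta0OfJs F κ)) ∧
    ¬ ∀ (F : T4Family) (κ : StepColourData), ∃ A : ℝ, OneLoopDrift (B12Normalization.stepBal 2 F.L) A (beta0OfJs F κ) := by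
  have h := exists_lim_eq_of_tableResponse_ne F hρ
  obtain ⟨κ, -, hκ⟩ := exists_not_drift_of_forall_exists_lim F h
  exact ⟨exists_drift_of_forall_exists_lim F h, ⟨κ, hκ⟩, not_d1DriftAll_of_forall_exists_lim F h⟩

/-- the disjunctive form used below: «σ_F ≠ 0 or some ρ_F(E) ≠ 0» ⟹ some colour datum of `F` is on the drift variety. [folklore] -/
theorem exists_drift_of_secondOrder_nonblind
    (h : CauchyRate.lim (beta0OfJs F ⟨0, 0, 0, 1, 0⟩) - CauchyRate.lim (beta0OfJs F ⟨0, 0, 0, 0, 0⟩) ≠ 0 ∨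
      ∃ E : Fin 4 → Fin 4 → Fin 4 → Fin 4 → ℝ, CauchyRate.lim (beta0OfJs F ⟨0, 0, 0, 0, E⟩) - CauchyRate.lim (beta0OfJs F ⟨0, 0, 0, 0, 0⟩) ≠ 0) :
    ∃ (κ : StepColourData) (A : ℝ), OneLoopDrift (B12Normalization.stepBal 2 F.L) A (beta0OfJs F κ) := by
  rcases h with hσ | ⟨E, hρ⟩
  · exact (twoVerdicts_of_borderSlope_ne F hσ).1
  · exact (twoVerdicts_of_tableResponse_ne F hρ).1

/-- … and in LIMIT currency: some κ with `lim_F κ = stepBal 2 F.L`. [folklore] -/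
theorem exists_onVariety_of_secondOrder_nonblind
    (h : CauchyRate.lim (beta0OfJs F ⟨0, 0, 0, 1, 0⟩) - CauchyRate.lim (beta0OfJs F ⟨0, 0, 0, 0, 0⟩) ≠ 0 ∨
      ∃ E : Fin 4 → Fin 4 → Fin 4 → Fin 4 → ℝ, CauchyRate.lim (beta0OfJs F ⟨0, 0, 0, 0, E⟩) - CauchyRate.lim (beta0OfJs F ⟨0, 0, 0, 0, 0⟩) ≠ 0) :
    ∃ κ : StepColourData, CauchyRate.lim (beta0OfJs F κ) = B12Normalization.stepBal 2 F.L := by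
  obtain ⟨κ, A, hA⟩ := exists_drift_of_secondOrder_nonblind F h
  exact ⟨κ, (drift_iff_lim_eq F κ 2).mp ⟨A, hA⟩⟩

/-- **UNDER `σ_F ≠ 0` THE DRIFT VARIETY IS A GRAPH OVER THE OTHER 259 COORDINATES**: a colour datum is on the variety iff its border weight is THE solved value
`cB = (stepBal 2 F.L − lim_F ⟨cE,cVH,cΛ,0,Tc⟩) ∕ σ_F` (g1-p1's `existsUnique_borderWeight_d1Drift` ∕ `…SecondOrderNormalForm.existsUnique_borderWeight_of_sigma_ne` read for `beta0OfJs`).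
So the variety then projects ONTO every first-order colour triple and every position table — a (β2)-type run text quantified over the WHOLE variety would ask the run letter at
colour data with ARBITRARY first-order weights (e.g. `c⃗ = 0`); a NAMED SUB-CLASS is the honest quantifier (plan g83 WORDS-3 allows it). [folklore] -/
theorem onVariety_iff_borderWeight_eq_of_borderSlope_ne
    (hσ : CauchyRate.lim (beta0OfJs F ⟨0, 0, 0, 1, 0⟩) - CauchyRate.lim (beta0OfJs F ⟨0, 0, 0, 0, 0⟩) ≠ 0)
    (cE cVH cΛ cB : ℝ) (Tc : Fin 4 → Fin 4 → Fin 4 → Fin 4 → ℝ) :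
    CauchyRate.lim (beta0OfJs F ⟨cE, cVH, cΛ, cB, Tc⟩) = B12Normalization.stepBal 2 F.L ↔
      cB = (B12Normalization.stepBal 2 F.L - CauchyRate.lim (beta0OfJs F ⟨cE, cVH, cΛ, 0, Tc⟩)) /
        (CauchyRate.lim (beta0OfJs F ⟨0, 0, 0, 1, 0⟩) - CauchyRate.lim (beta0OfJs F ⟨0, 0, 0, 0, 0⟩)) := by
  rw [lim_border_translate, eq_div_iff hσ]
  constructor
  · intro h
    linarith
  · intro h
    linarith

/-- … hence under `σ_F ≠ 0` EVERY first-order colour triple and EVERY position table carry EXACTLY ONE border weight on the variety (the variety is non-empty over every fibre). [folklore] -/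
theorem existsUnique_borderWeight_onVariety_of_borderSlope_ne
    (hσ : CauchyRate.lim (beta0OfJs F ⟨0, 0, 0, 1, 0⟩) - CauchyRate.lim (beta0OfJs F ⟨0, 0, 0, 0, 0⟩) ≠ 0)
    (cE cVH cΛ : ℝ) (Tc : Fin 4 → Fin 4 → Fin 4 → Fin 4 → ℝ) :
    ∃! cB : ℝ, CauchyRate.lim (beta0OfJs F ⟨cE, cVH, cΛ, cB, Tc⟩) = B12Normalization.stepBal 2 F.L := by
  refine ⟨(B12Normalization.stepBal 2 F.L - CauchyRate.lim (beta0OfJs F ⟨cE, cVH, cΛ, 0, Tc⟩)) /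
      (CauchyRate.lim (beta0OfJs F ⟨0, 0, 0, 1, 0⟩) - CauchyRate.lim (beta0OfJs F ⟨0, 0, 0, 0, 0⟩)),
    (onVariety_iff_borderWeight_eq_of_borderSlope_ne F hσ cE cVH cΛ _ Tc).mpr rfl, fun cB hcB => ?_⟩
  exact (onVariety_iff_borderWeight_eq_of_borderSlope_ne F hσ cE cVH cΛ cB Tc).mp hcB

/-- … in drift currency: under `σ_F ≠ 0`, for every colour triple and table some border weight puts the datum on the drift variety — `∃ cB A, OneLoopDrift (stepBal 2 F.L) A (beta0OfJs F ⟨cE,cVH,cΛ,cB,Tc⟩)`. [folklore] -/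
theorem exists_borderWeight_drift_of_borderSlope_ne
    (hσ : CauchyRate.lim (beta0OfJs F ⟨0, 0, 0, 1, 0⟩) - CauchyRate.lim (beta0OfJs F ⟨0, 0, 0, 0, 0⟩) ≠ 0)
    (cE cVH cΛ : ℝ) (Tc : Fin 4 → Fin 4 → Fin 4 → Fin 4 → ℝ) :
    ∃ (cB A : ℝ), OneLoopDrift (B12Normalization.stepBal 2 F.L) A (beta0OfJs F ⟨cE, cVH, cΛ, cB, Tc⟩) := by
  obtain ⟨cB, hcB, -⟩ := existsUnique_borderWeight_onVariety_of_borderSlope_ne F hσ cE cVH cΛ Tc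
  obtain ⟨A, hA⟩ := (drift_iff_lim_eq F ⟨cE, cVH, cΛ, cB, Tc⟩ 2).mpr hcB
  exact ⟨cB, A, hA⟩

/-- for LINE 2″ (the SIGN edition, gen 0 §4): second-order non-blindness at `F` gives a colour datum with POSITIVE one-loop limit (value `1`); whether it ANCHORS a record is record
content, untouched. [folklore] -/
theorem exists_lim_pos_of_secondOrder_nonblind
    (h : CauchyRate.lim (beta0OfJs F ⟨0, 0, 0, 1, 0⟩) - CauchyRate.lim (beta0OfJs F ⟨0, 0, 0, 0, 0⟩) ≠ 0 ∨
      ∃ E : Fin 4 → Fin 4 → Fin 4 → Fin 4 → ℝ, CauchyRate.lim (beta0OfJs F ⟨0, 0, 0, 0, E⟩) - CauchyRate.lim (beta0OfJs F ⟨0, 0, 0, 0, 0⟩) ≠ 0) :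
    ∃ κ : StepColourData, 0 < CauchyRate.lim (beta0OfJs F κ) := by
  rcases h with hσ | ⟨E, hρ⟩
  · obtain ⟨κ, hκ⟩ := exists_lim_eq_of_borderSlope_ne F hσ 1
    exact ⟨κ, by rw [hκ]; exact one_pos⟩
  · obtain ⟨κ, hκ⟩ := exists_lim_eq_of_tableResponse_ne F hρ 1
    exact ⟨κ, by rw [hκ]; exact one_pos⟩

end TwoVerdicts

/-! ## §3 The two PRICES per family (intrinsic): an EMPTY variety, like the FULL one, forces second-order blindness; the blind residual is the colour quartic alone -/

section Prices

variable (F : T4Family)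

/-- **PRICE OF AN EMPTY VARIETY**: if NO colour datum of `F` drifts with Bałaban's slope then `σ_F = 0` and `ρ_F ≡ 0` (contrapositive of §2). [folklore] -/
theorem secondOrderBlind_of_varietyEmpty
    (h : ¬ ∃ (κ : StepColourData) (A : ℝ), OneLoopDrift (B12Normalization.stepBal 2 F.L) A (beta0OfJs F κ)) :
    CauchyRate.lim (beta0OfJs F ⟨0, 0, 0, 1, 0⟩) - CauchyRate.lim (beta0OfJs F ⟨0, 0, 0, 0, 0⟩) = 0 ∧
      ∀ E : Fin 4 → Fin 4 → Fin 4 → Fin 4 → ℝ, CauchyRate.lim (beta0OfJs F ⟨0, 0, 0, 0, E⟩) - CauchyRate.lim (beta0OfJs F ⟨0, 0, 0, 0, 0⟩) = 0 := by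
  refine ⟨by_contra fun hσ => h (twoVerdicts_of_borderSlope_ne F hσ).1, fun E => by_contra fun hρ => h ?_⟩
  exact (twoVerdicts_of_tableResponse_ne F hρ).1

/-- **PRICE OF A FULL VARIETY, per family** (d1-w2's `normalForm_trivial_of_d1DriftAll` in intrinsic letters): if EVERY colour datum of `F` drifts then `σ_F = 0` and `ρ_F ≡ 0`. [folklore] -/
theorem secondOrderBlind_of_varietyFull
    (h : ∀ κ : StepColourData, ∃ A : ℝ, OneLoopDrift (B12Normalization.stepBal 2 F.L) A (beta0OfJs F κ)) :
    CauchyRate.lim (beta0OfJs F ⟨0, 0, 0, 1, 0⟩) - CauchyRate.lim (beta0OfJs F ⟨0, 0, 0, 0, 0⟩) = 0 ∧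
      ∀ E : Fin 4 → Fin 4 → Fin 4 → Fin 4 → ℝ, CauchyRate.lim (beta0OfJs F ⟨0, 0, 0, 0, E⟩) - CauchyRate.lim (beta0OfJs F ⟨0, 0, 0, 0, 0⟩) = 0 := by
  refine ⟨by_contra fun hσ => ?_, fun E => by_contra fun hρ => ?_⟩
  · obtain ⟨κ, hκ⟩ := (twoVerdicts_of_borderSlope_ne F hσ).2.1
    exact hκ (h κ)
  · obtain ⟨κ, hκ⟩ := (twoVerdicts_of_tableResponse_ne F hρ).2.1
    exact hκ (h κ)

/-- **THE SECOND-ORDER-BLIND RESIDUAL IS THE COLOUR QUARTIC ALONE**: if `σ_F = 0` and `ρ_F ≡ 0` then a colour datum drifts iff its colour-triple member `⟨cE, cVH, cΛ, 0, 0⟩` does —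
the (D1) question at `F` no longer sees the border weight or the position table (γ_F + Φ_F(c⃗) = stepBal 2 F.L, d1-w2 §1). [folklore] -/
theorem drift_iff_colourTriple_of_secondOrderBlind
    (hσ : CauchyRate.lim (beta0OfJs F ⟨0, 0, 0, 1, 0⟩) - CauchyRate.lim (beta0OfJs F ⟨0, 0, 0, 0, 0⟩) = 0)
    (hρ : ∀ E : Fin 4 → Fin 4 → Fin 4 → Fin 4 → ℝ, CauchyRate.lim (beta0OfJs F ⟨0, 0, 0, 0, E⟩) - CauchyRate.lim (beta0OfJs F ⟨0, 0, 0, 0, 0⟩) = 0)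
    (κ : StepColourData) :
    (∃ A : ℝ, OneLoopDrift (B12Normalization.stepBal 2 F.L) A (beta0OfJs F κ)) ↔
      ∃ A : ℝ, OneLoopDrift (B12Normalization.stepBal 2 F.L) A (beta0OfJs F ⟨κ.cE, κ.cVH, κ.cΛ, 0, 0⟩) := by
  have hlim : CauchyRate.lim (beta0OfJs F κ) = CauchyRate.lim (beta0OfJs F ⟨κ.cE, κ.cVH, κ.cΛ, 0, 0⟩) := by
    rw [lim_secondOrder_split F κ, hσ, hρ κ.Tc]
    ring
  rw [drift_iff_lim_eq F κ 2, drift_iff_lim_eq F _ 2, hlim]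

end Prices

/-! ## §4 A family enters only through its block; second-order non-blindness at every family ⟹ the θ-free (D1) text 1ᴰ for SOME pin -/

section Pin

/-- **THE NAMED NUMBERS SEE A FAMILY ONLY THROUGH ITS BLOCK `F.L`** (DEF-1's `beta0OfJs F κ` unfolds to the pinned literal at `Lc := F.L`; the other fields of `T4Family` — the
torus exponent `m` and the proofs — do not enter). [folklore] -/
theorem beta0OfJs_eq_of_L_eq {F F' : T4Family} (h : F.L = F'.L) (κ : StepColourData) : beta0OfJs F κ = beta0OfJs F' κ := by
  obtain ⟨L, hL, hL11, m, hm⟩ := F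
  obtain ⟨L', hL', hL11', m', hm'⟩ := F'
  dsimp only at h
  subst h
  rfl

/-- **per-family inhabitants assemble to ONE pin**: if at EVERY family some colour datum drifts, there is `κ⋆ : ℕ → StepColourData` with the drift at `κ⋆ F.L` for every family — plan
g83 (β2)'s θ-free text 1ᴰ, i.e. the `hD1` hypothesis of DEF-1's `K2V6Defs.EndpointGivenBR13SepCoPH_of_pin` ∕ `d1AtAnchoredJets_of_pin` (the pin is CHOSEN per block by
`Classical.choose`; it is NOT print's (P6) datum and nothing here identifies it). [folklore] -/
theorem exists_pin_drift_of_forall_exists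
    (h : ∀ F : T4Family, ∃ (κ : StepColourData) (A : ℝ), OneLoopDrift (B12Normalization.stepBal 2 F.L) A (beta0OfJs F κ)) :
    ∃ κs : ℕ → StepColourData, ∀ F : T4Family, ∃ A : ℝ, OneLoopDrift (B12Normalization.stepBal 2 F.L) A (beta0OfJs F (κs F.L)) := by
  classical
  refine ⟨fun L => if hL : (Odd L ∧ 1 < L) ∧ 11 < L then Classical.choose (h ⟨L, hL.1, hL.2, 1, le_rfl⟩) else ⟨0, 0, 0, 0, 0⟩,
    fun F => ?_⟩
  have hF : (Odd F.L ∧ 1 < F.L) ∧ 11 < F.L := ⟨F.hL, F.hL11⟩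
  dsimp only
  rw [dif_pos hF]
  obtain ⟨A, hA⟩ := Classical.choose_spec (h ⟨F.L, hF.1, hF.2, 1, le_rfl⟩)
  refine ⟨A, ?_⟩
  rw [beta0OfJs_eq_of_L_eq (F := F) (F' := ⟨F.L, hF.1, hF.2, 1, le_rfl⟩) rfl]
  exact hA

/-- **★ SECOND-ORDER NON-BLINDNESS AT EVERY FAMILY ⟹ THE θ-FREE (D1) TEXT 1ᴰ FOR SOME PIN**: if at every family the border slope `σ_F` or some table response `ρ_F(E)` is non-zero,
then `∃ κ⋆ : ℕ → StepColourData, ∀ F, ∃ A, OneLoopDrift (stepBal 2 F.L) A (beta0OfJs F (κ⋆ F.L))`.  The hypothesis asks for ONE non-zero second-order coefficient per block (odd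
`L ≥ 13`, `T4Family.hL11`) — NOT for print's colour weights and NOT for the value of any limit.  NO coefficient is certified here. [folklore] -/
theorem exists_pin_drift_of_secondOrder_nonblind
    (h : ∀ F : T4Family,
      CauchyRate.lim (beta0OfJs F ⟨0, 0, 0, 1, 0⟩) - CauchyRate.lim (beta0OfJs F ⟨0, 0, 0, 0, 0⟩) ≠ 0 ∨
        ∃ E : Fin 4 → Fin 4 → Fin 4 → Fin 4 → ℝ, CauchyRate.lim (beta0OfJs F ⟨0, 0, 0, 0, E⟩) - CauchyRate.lim (beta0OfJs F ⟨0, 0, 0, 0, 0⟩) ≠ 0) :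
    ∃ κs : ℕ → StepColourData, ∀ F : T4Family, ∃ A : ℝ, OneLoopDrift (B12Normalization.stepBal 2 F.L) A (beta0OfJs F (κs F.L)) :=
  exists_pin_drift_of_forall_exists fun F => exists_drift_of_secondOrder_nonblind F (h F)

end Pin

/-! ## §5 The crux decl BY NAME from second-order non-blindness + the (β2) class run text -/

section Crux

/-- **★★ SECOND-ORDER NON-BLINDNESS + 2ᴼ ⟹ THE CRUX DECL BY NAME** (`Summit.QuantumFields.YangMills.Theses.BalabanUVNodes.EndpointGivenBR13SepCoPH`): if (i) at every family `σ_F ≠ 0` or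
some `ρ_F(E) ≠ 0`, and (ii) [plan g83 (β2)'s class text 2ᴼ, pointwise] at every tuple carrying v6's prefix the run letter `RunRemAt F κ θ hP θ.cβ` holds at EVERY colour datum κ ON the
drift variety `lim_F κ = stepBal 2 F.L`, then the crux decl — per tuple, (i) inhabits the variety (§2), (ii) runs there, gen 0's LINE 1″ concluder `EndpointGivenBR13SepCoPH_of_runRemAtOnVariety`
ends.  CONDITIONAL on two hypothesis shapes (instance 0∕1 each; 2ᴼ's uniformity over the variety may be FALSE — plan g83 WORDS-3); K2⁷ NOT closed; nothing of Bałaban asserted.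
[cite: Balaban1987RG1, Thm 2 p.259 (first sentence), (1.22) p.264 and (2.12)–(2.14) p.268] -/
theorem EndpointGivenBR13SepCoPH_of_secondOrder_nonblind_runOnVariety
    (h₁ : ∀ F : T4Family,
      CauchyRate.lim (beta0OfJs F ⟨0, 0, 0, 1, 0⟩) - CauchyRate.lim (beta0OfJs F ⟨0, 0, 0, 0, 0⟩) ≠ 0 ∨
        ∃ E : Fin 4 → Fin 4 → Fin 4 → Fin 4 → ℝ, CauchyRate.lim (beta0OfJs F ⟨0, 0, 0, 0, E⟩) - CauchyRate.lim (beta0OfJs F ⟨0, 0, 0, 0, 0⟩) ≠ 0)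
    (h₂ : ∀ (F : T4Family) (κ : StepColourData) (θ : Node00.Stage13HParams F 2) (hP : θ.Provisos₁₃SepCoPH F 2),
      (θ.ZhUnity F 2 ∧ θ.SlotsNondegenerate₁₃ F 2) → θ.Admissible F 2 →
      B16.EndStatementBPrinted (Node00.datumOfRecord₁₃SepCoPH F 2 θ hP).C → Window13 F θ hP →
      CauchyRate.lim (beta0OfJs F κ) = B12Normalization.stepBal 2 F.L → RunRemAt F κ θ hP θ.cβ) :
    Summit.QuantumFields.YangMills.Theses.BalabanUVNodes.EndpointGivenBR13SepCoPH :=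
  EndpointGivenBR13SepCoPH_of_runRemAtOnVariety fun F θ hP hU hθ hB hwin => by
    obtain ⟨κ, hκ⟩ := exists_onVariety_of_secondOrder_nonblind F (h₁ F)
    exact ⟨κ, hκ, h₂ F κ θ hP hU hθ hB hwin hκ⟩

/-- **★★ THE SAME, WITH 2ᴼ ASKED ONLY AT PINS**: (i) as above; (ii′) for EVERY pin `κ⋆ : ℕ → StepColourData` whose members drift at every family, the run letter at `κ⋆ F.L` under v6's
prefix ⟹ the crux decl (§4's chosen pin fed to DEF-1's `K2V6Defs.EndpointGivenBR13SepCoPH_of_pin`).  CONDITIONAL; K2⁷ NOT closed. [cite: Balaban1987RG1, Thm 2 p.259 (first sentence) and (2.12)–(2.14) p.268] -/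
theorem EndpointGivenBR13SepCoPH_of_secondOrder_nonblind_runAtPins
    (h₁ : ∀ F : T4Family,
      CauchyRate.lim (beta0OfJs F ⟨0, 0, 0, 1, 0⟩) - CauchyRate.lim (beta0OfJs F ⟨0, 0, 0, 0, 0⟩) ≠ 0 ∨
        ∃ E : Fin 4 → Fin 4 → Fin 4 → Fin 4 → ℝ, CauchyRate.lim (beta0OfJs F ⟨0, 0, 0, 0, E⟩) - CauchyRate.lim (beta0OfJs F ⟨0, 0, 0, 0, 0⟩) ≠ 0)
    (h₂ : ∀ κs : ℕ → StepColourData, (∀ F : T4Family, ∃ A : ℝ, OneLoopDrift (B12Normalization.stepBal 2 F.L) A (beta0OfJs F (κs F.L))) →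
      ∀ (F : T4Family) (θ : Node00.Stage13HParams F 2) (hP : θ.Provisos₁₃SepCoPH F 2), (θ.ZhUnity F 2 ∧ θ.SlotsNondegenerate₁₃ F 2) → θ.Admissible F 2 →
      B16.EndStatementBPrinted (Node00.datumOfRecord₁₃SepCoPH F 2 θ hP).C → Window13 F θ hP → RunRemAt F (κs F.L) θ hP θ.cβ) :
    Summit.QuantumFields.YangMills.Theses.BalabanUVNodes.EndpointGivenBR13SepCoPH := by
  obtain ⟨κs, hκs⟩ := exists_pin_drift_of_secondOrder_nonblind h₁
  exact EndpointGivenBR13SepCoPH_of_pin κs hκs (h₂ κs hκs)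

end Crux

end Summit.QuantumFields.YangMills.Theorems.BalabanUVNodesK2D1VarietySecondOrder

end
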